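import Summits.CriticalPhenomena.PercolationContinuityZ3.Theorems.PercNearOneGluingNoHeavyLowerTailCrossHarrisTerminalRC
import Mathlib.Tactic.Linarith
import HarnessLib

/-!
# Cross-Harris at a terminal for `φ_{𝐩,q}`, `q ≥ 1` — the general form: any increasing event of the apex CLUSTER

Support file for `stmt-CriticalPhenomena-4575` (memo `prim-gen-kcluster/KCLUSTER-gen67.md` §1–§2; prover prim-gen-kcluster
gen 67); companion of `…LowerTailCrossHarrisTerminalRC.lean` (`CrossHarrisRC.unwire`, `crossHarris_terminal_rc`).  No named
facts, no sorries, no new definitions.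

The un-wiring lemma holds for EVERY increasing event of the open cluster of the apex, `{C_a ∈ 𝒰}` with `𝒰` an up-set of
vertex sets (`openCluster ω a ∈ 𝒰`; this is the FK sub-lane's `FK.clusterIn a 𝒰`, definitionally):
* `CrossHarrisRC.unwire_cluster` — `q ≥ 1`, `w₁ ≤ w₂` off the star of `b`:
  `φ_{w₁}(a ↮ b, C_a ∈ 𝒰) ≤ φ_{w₁}(a ↮ b) · φ_{w₂}(C_a ∈ 𝒰)` (domain Markov given `C_b`, vdBHK Lemma 2.3/2.4 = tree
  `BHK2006.rc_set_sum_cond_cluster`, + comparison in `𝐩`, tree `sum_rcMass_mono_weights`);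
* `CrossHarrisRC.crossHarris_terminal_rc_cluster` — `w₁ = w₂` off the star of `b`:
  `φ_{w₁}(a↔b)φ_{w₂}(C_a ∈ 𝒰) + φ_{w₂}(a↔b)φ_{w₁}(C_a ∈ 𝒰) ≤ φ_{w₁}(a↔b, C_a ∈ 𝒰) + φ_{w₂}(a↔b, C_a ∈ 𝒰)`:
  the positive correlation of `{a ↔ b}` with any increasing cluster event is superadditive over the boundary law of the
  terminal `b` (`𝒰 = {S ∋ c}` is `crossHarris_terminal_rc`; `𝒰 = {S : S ∩ X ≠ ∅}` is `crossHarris_terminal_rc_set`).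
SCOPE (memo §2, census): for events NOT determined by `C_a` (single edges, `{u ↔ v}` with `u, v ≠ a`) both statements are
FALSE — the mixture `β₁φ₁(·|a↔b) + β₂φ₂(·|a↔b)` dominates `β₁φ₂ + β₂φ₁` on the lattice of apex clusters, not on the edge lattice.
[this work] [cite: VandenbergHaggstromKahn2005, §2.1 Lemmas 2.3–2.4 (p. 10)] [cite: Grimmett2006, Thm. (3.21) (p. 43)]
-/

noncomputable section

namespace Summit.CriticalPhenomena.PercolationContinuityZ3.Theorems

namespace CrossHarrisRC

open MeasureTheory Literature.Probability.Percolation Literature.Probability.LatticeModels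
open Literature.Probability.Percolation.BHK2006
open Literature.Probability.Percolation.DecisionTree (ind ind_of_mem ind_of_not_mem ind_nonneg)
open scoped Classical

variable {V : Type*} [Fintype V]

omit [Fintype V] in
/-- The apex cluster read off the open edge cluster of `{a}`: `C_a = {a} ∪ V(C_{{a}})`. [folklore] -/
theorem openCluster_eq_of_setCl (ω : BondConfig V) (a : V) :
    openCluster ω a = {v | v ∈ ({a} : Set V) ∨ ∃ e ∈ setCl ω {a}, v ∈ e} := by
  ext v
  exact reachable_iff_setCl_singleton ω a v

omit [Fintype V] in
/-- `{C_a ∈ 𝒰}` is increasing for an up-set `𝒰`. [folklore] -/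
theorem isUpperSet_openCluster_mem (a : V) {𝒰 : Set (Set V)} (h𝒰 : IsUpperSet 𝒰) :
    IsUpperSet {ω : BondConfig V | openCluster ω a ∈ 𝒰} :=
  fun _ _ hle hω => h𝒰 (fun _ hy => SimpleGraph.Reachable.mono (SimpleGraph.fromEdgeSet_mono hle) hy) hω

/-- **Un-wiring a terminal, cluster form.**  `q ≥ 1`; `w₁ ≤ w₂` on the pairs not containing `b`; `𝒰` an up-set of
vertex sets.  Then `φ_{w₁,q}(a ↮ b, C_a ∈ 𝒰) ≤ φ_{w₁,q}(a ↮ b) · φ_{w₂,q}(C_a ∈ 𝒰)`: conditionally on not being joined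
to the terminal, the law of the apex cluster is dominated by its law under ANY boundary law at `b` over parameters at
least `w₁` elsewhere. [this work] -/
theorem unwire_cluster {q : ℝ} (hq : 1 ≤ q) {w₁ w₂ : Sym2 V → unitInterval} {b : V}
    (h : ∀ e : Sym2 V, b ∉ e → w₁ e ≤ w₂ e) (a : V) {𝒰 : Set (Set V)} (h𝒰 : IsUpperSet 𝒰) :
    (rcMeasureW w₁ q ∅).real ({ω : BondConfig V | openCluster ω a ∈ 𝒰} \ openConn a b) ≤
      (rcMeasureW w₁ q ∅).real (openConn a b : Set (BondConfig V))ᶜ *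
        (rcMeasureW w₂ q ∅).real {ω : BondConfig V | openCluster ω a ∈ 𝒰} := by
  have hq0 : 0 < q := one_pos.trans_le hq
  set C : Set (BondConfig V) := {ω : BondConfig V | openCluster ω a ∈ 𝒰} with hCdef
  set D : Set (BondConfig V) := (openConn a b : Set (BondConfig V))ᶜ with hDdef
  have hD : ∀ ω, ω ∈ D ↔ ∀ s ∈ ({b} : Set V), ∀ t ∈ ({a} : Set V), ¬ (openGraph ω).Reachable s t := by
    intro ω
    simp only [hDdef, Set.mem_compl_iff, openConn, Set.mem_setOf_eq, Set.mem_singleton_iff,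
      forall_eq]
    exact ⟨fun hn hba => hn hba.symm, fun hn hab => hn hab.symm⟩
  set H : Set (Sym2 V) → Set (Sym2 V) → ℝ := fun _ W' =>
    if ({v | v ∈ ({a} : Set V) ∨ ∃ e ∈ W', v ∈ e} ∈ 𝒰) then 1 else 0 with hHdef
  have hH' : ∀ (W : Set (Sym2 V)) (η : BondConfig V), H W (setCl η {a}) = ind C η := by
    intro W η
    have hC : η ∈ C ↔ {v | v ∈ ({a} : Set V) ∨ ∃ e ∈ setCl η {a}, v ∈ e} ∈ 𝒰 := by
      rw [← openCluster_eq_of_setCl η a]; exact Iff.rfl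
    by_cases hη : η ∈ C
    · rw [ind_of_mem hη]; exact if_pos (hC.1 hη)
    · rw [ind_of_not_mem hη]; exact if_neg fun h' => hη (hC.2 h')
  have hCD : C \ (openConn a b : Set (BondConfig V)) = C ∩ D := by
    ext ω
    simp only [Set.mem_sdiff, Set.mem_inter_iff, hDdef, Set.mem_compl_iff]
  have key := rc_set_sum_cond_cluster w₁ hq0 {b} {a} H hD
  set γ₂ : ℝ := (rcMeasureW w₂ q ∅).real C with hγ₂
  have hγ₂sum : γ₂ = ∑ η, rcMass w₂ q η * ind C η := rcMeasureW_real_eq_sum_rcMass w₂ hq0 C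
  have hmono : Monotone (ind C) := ind_mono_of_isUpperSet (isUpperSet_openCluster_mem a h𝒰)
  have hinner : ∀ ω : BondConfig V,
      ∑ η, rcMass (delW w₁ (barOf {b} (setCl ω {b}))) q η * H (setCl ω {b}) (setCl η {a}) ≤ γ₂ := by
    intro ω
    simp only [hH']
    rw [hγ₂sum]
    exact sum_rcMass_mono_weights (delW_barOf_le h (setCl ω {b})) hq hmono
  have hL : (rcMeasureW w₁ q ∅).real (C \ openConn a b) =
      ∑ ω, rcMass w₁ q ω * (H (setCl ω {b}) (setCl ω {a}) * ind D ω) := by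
    rw [hCD, rcMeasureW_real_eq_sum_rcMass w₁ hq0]
    refine Finset.sum_congr rfl fun ω _ => ?_
    rw [hH' (setCl ω {b}) ω, ind_inter]
  have hR : (rcMeasureW w₁ q ∅).real D = ∑ ω, rcMass w₁ q ω * ind D ω :=
    rcMeasureW_real_eq_sum_rcMass w₁ hq0 D
  rw [hL, key, hR, Finset.sum_mul]
  refine Finset.sum_le_sum fun ω _ => ?_
  have hm : 0 ≤ rcMass w₁ q ω := rcMass_nonneg w₁ hq0 ω
  have hi : 0 ≤ ind D ω := ind_nonneg D ω
  calc rcMass w₁ q ω * ((∑ η, rcMass (delW w₁ (barOf {b} (setCl ω {b}))) q η *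
          H (setCl ω {b}) (setCl η {a})) * ind D ω)
      ≤ rcMass w₁ q ω * (γ₂ * ind D ω) :=
        mul_le_mul_of_nonneg_left (mul_le_mul_of_nonneg_right (hinner ω) hi) hm
    _ = rcMass w₁ q ω * ind D ω * γ₂ := by ring

/-- **Cross-Harris at a terminal, cluster form** (`q ≥ 1`; `w₁ = w₂` off the star of `b`; `𝒰` an up-set of vertex
sets): `φ_{w₁}(a↔b)·φ_{w₂}(C_a ∈ 𝒰) + φ_{w₂}(a↔b)·φ_{w₁}(C_a ∈ 𝒰) ≤ φ_{w₁}(a↔b, C_a ∈ 𝒰) + φ_{w₂}(a↔b, C_a ∈ 𝒰)` — the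
positive correlation of `{a ↔ b}` with every increasing event of the apex cluster is superadditive over the boundary law
of `b`. [this work] -/
theorem crossHarris_terminal_rc_cluster {q : ℝ} (hq : 1 ≤ q) {w₁ w₂ : Sym2 V → unitInterval} {b : V}
    (h : ∀ e : Sym2 V, b ∉ e → w₁ e = w₂ e) (a : V) {𝒰 : Set (Set V)} (h𝒰 : IsUpperSet 𝒰) :
    (rcMeasureW w₁ q ∅).real (openConn a b : Set (BondConfig V)) *
        (rcMeasureW w₂ q ∅).real {ω : BondConfig V | openCluster ω a ∈ 𝒰} +
      (rcMeasureW w₂ q ∅).real (openConn a b : Set (BondConfig V)) *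
        (rcMeasureW w₁ q ∅).real {ω : BondConfig V | openCluster ω a ∈ 𝒰} ≤
      (rcMeasureW w₁ q ∅).real ((openConn a b : Set (BondConfig V)) ∩
          {ω : BondConfig V | openCluster ω a ∈ 𝒰}) +
        (rcMeasureW w₂ q ∅).real ((openConn a b : Set (BondConfig V)) ∩
          {ω : BondConfig V | openCluster ω a ∈ 𝒰}) := by
  have hq0 : 0 < q := one_pos.trans_le hq
  haveI := isProbabilityMeasure_rcMeasureW w₁ hq0 ∅
  haveI := isProbabilityMeasure_rcMeasureW w₂ hq0 ∅
  set μ₁ := rcMeasureW w₁ q ∅ with hμ₁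
  set μ₂ := rcMeasureW w₂ q ∅ with hμ₂
  set B : Set (BondConfig V) := openConn a b with hB
  set C : Set (BondConfig V) := {ω : BondConfig V | openCluster ω a ∈ 𝒰} with hC
  have hmeas : MeasurableSet B := MeasurableSet.of_discrete
  have n1 := unwire_cluster hq (fun e he => (h e he).le) a h𝒰
  have n2 := unwire_cluster hq (fun e he => (h e he).symm.le) a h𝒰
  have c1 : μ₁.real Bᶜ = 1 - μ₁.real B := probReal_compl_eq_one_sub hmeas
  have c2 : μ₂.real Bᶜ = 1 - μ₂.real B := probReal_compl_eq_one_sub hmeas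
  have s1 : μ₁.real (C ∩ B) + μ₁.real (C \ B) = μ₁.real C :=
    measureReal_inter_add_sdiff hmeas (measure_ne_top _ _)
  have s2 : μ₂.real (C ∩ B) + μ₂.real (C \ B) = μ₂.real C :=
    measureReal_inter_add_sdiff hmeas (measure_ne_top _ _)
  rw [Set.inter_comm B C]
  rw [c1] at n1
  rw [c2] at n2
  nlinarith [n1, n2, s1, s2]

end CrossHarrisRC

end Summit.CriticalPhenomena.PercolationContinuityZ3.Theorems
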